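/-
Copyright: derived here (Resolution Observatory cell `pub-rosobs`, carver gen 57). AI-written Lean; AI review is weaker than expert
review.  Two pieces of support bookkeeping of engine 1's THEOREM LT §1–§2 (the `h`-decomposition `g = Σ_h h · G_h` and "no `C`-variable
in any `D(X_i)` by weight") for the cell's POLYNOMIAL weighted-centre model `W(f)`.  Instrument — NOT a resolution theorem and NOT a
statement about the invariant of [AbramovichTemkinWlodarczyk2024].
-/
import Literature.AlgebraicGeometry.Resolution.WeightedCentreGradedPureVectors
import Mathlib.RingTheory.MvPolynomial.WeightedHomogeneous
import HarnessLib

/-!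
# The heavy factorisation `Q = X^h · G_h` and class-freeness by weight (THEOREM LT §1–§2 bookkeeping)

Uniform value line: INSTRUMENT — kernel-checked bookkeeping for engine 1's THEOREM LT (THEOREM-LT-eng1-g38 §1 "`g = Σ_h h · G_h`, `G_h` in
the `C`- and light variables", §2 "`D(X_i)` involves no `C`-variable, by weight") in the cell's polynomial weighted-centre model `W(f)`; NOT a
resolution theorem, NOT a statement about the Abramovich–Temkin–Włodarczyk invariant, NOT summit progress; AI-written Lean, AI review weaker
than expert review.  Companion of `WeightedCentreDerivationLayers` (whose hypotheses `IsWeightedHomogeneous N (D (X i)) 0` and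
`Q = monomial h r * G` this file discharges from the engine's data) — kept import-free of it.

* `isWeightedHomogeneous_zero_of_weight_lt` (**class-freeness by weight**): weights `w ≥ 0`, a class `C` of slots of weight `≥ w₀`, and `Q`
  `w`-homogeneous of a weight `κ < w₀` ⇒ `Q` has degree `0` for every `ℕ`-weight `N` vanishing off `C` (no `C`-variable occurs in `Q`).  In LT:
  `D(ε_f) = T_f` has weight `w₀ − ρ < w₀`, `D(x_i)` has weight `w_i − ρ < w₀` for light `i`, `D(y) = 0` — so every `D(X_i)` is `C`-free.
  (For `N = blockWeight C` the equivalence "degree `0` ⟺ no `C`-variable in the support" is the tree's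
  `isWeightedHomogeneous_zero_of_blockFree` / `blockFree_of_isWeightedHomogeneous_zero`, file `WeightedCentreOneRound`.)
* `heavyExp H : σ → (σ →₀ ℕ)` (`e_y` on the heavy slots `y ∈ H`, `0` elsewhere): `weight (heavyExp H) d = d|_H` (`weight_heavyExp`), so the
  `heavyExp`-components of `g` sort `g` by the HEAVY PART `h` of its monomials: `comp_h g = h · G_h`.
* `heavyQuot h Q := Σ_d coeff_d Q · X^{d − h}` and **`eq_monomial_mul_heavyQuot`**: a `heavyExp`-homogeneous `Q` of degree `h` IS `X^h · heavyQuot h Q`,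
  with `heavyQuot h Q` heavy-free (`isWeightedHomogeneous_heavyQuot`: degree `0`), `h` supported on `H` (`support_subset_of_isWeightedHomogeneous`),
  and the cofactor unique over a domain (`heavyQuot_unique`).  With `WeightedCentreDerivationLayers`: `D g = 0 ⇒ D (comp_h g) = 0 ⇒ D (G_h) = 0`.

References: [AbramovichTemkinWlodarczyk2024] §5 (weights and the graded structure of a weighted centre; context only).  Statements ours,
elementary.
-/

namespace Literature.AlgebraicGeometry.Resolution.WeightedBlowup

namespace HeavyDecomposition

open MvPolynomial

variable {σ R : Type*} [CommRing R]

/-! ## Class-freeness by weight -/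

section ClassFree

variable {M : Type*} [AddCommGroup M] [PartialOrder M] [IsOrderedAddMonoid M] {w : σ → M}

/-- A monomial none of whose variables carries `N`-weight has `N`-weight `0` (plumbing). [cite: AbramovichTemkinWlodarczyk2024, §5] -/
theorem weight_eq_zero_of_forall {N : σ → ℕ} {d : σ →₀ ℕ} (h : ∀ i ∈ d.support, N i = 0) : Finsupp.weight N d = 0 := by
  rw [Finsupp.weight_apply, Finsupp.sum]
  exact Finset.sum_eq_zero fun i hi => by rw [h i hi, smul_zero]

/-- **Class-freeness by weight.**  Weights `w ≥ 0`; `C` a set of slots of weight `≥ w₀`; `Q` `w`-homogeneous of weight `κ < w₀`.  Then no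
`C`-variable occurs in `Q`: `Q` is homogeneous of degree `0` for every `ℕ`-weight `N` vanishing off `C` (e.g. the `C`-degree).
[cite: AbramovichTemkinWlodarczyk2024, §5] -/
theorem isWeightedHomogeneous_zero_of_weight_lt (hw : ∀ j, 0 ≤ w j) {C : Set σ} {w₀ : M} (hC : ∀ f ∈ C, w₀ ≤ w f)
    {N : σ → ℕ} (hNL : ∀ i ∉ C, N i = 0) {Q : MvPolynomial σ R} {κ : M} (hQ : IsWeightedHomogeneous w Q κ) (hκ : κ < w₀) :
    IsWeightedHomogeneous N Q 0 := by
  intro d hd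
  refine weight_eq_zero_of_forall fun i hi => hNL i fun hiC => ?_
  have hiv : i ∈ Q.vars := (mem_vars_iff_mem_support i).mpr ⟨d, mem_support_iff.mpr hd, hi⟩
  exact (lt_of_lt_of_le hκ (hC i hiC)).not_ge (weight_le_of_mem_vars_of_isWeightedHomogeneous hw hQ hiv)

/-- Pointwise reading: no `C`-variable occurs in such a `Q`. [cite: AbramovichTemkinWlodarczyk2024, §5] -/
theorem notMem_vars_of_weight_lt (hw : ∀ j, 0 ≤ w j) {C : Set σ} {w₀ : M} (hC : ∀ f ∈ C, w₀ ≤ w f)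
    {Q : MvPolynomial σ R} {κ : M} (hQ : IsWeightedHomogeneous w Q κ) (hκ : κ < w₀) {f : σ} (hf : f ∈ C) : f ∉ Q.vars :=
  fun hfv => (lt_of_lt_of_le hκ (hC f hf)).not_ge (weight_le_of_mem_vars_of_isWeightedHomogeneous hw hQ hfv)

end ClassFree

/-! ## The heavy-part weight and the factorisation `Q = X^h · G_h` -/

section Heavy

variable (H : Set σ) [DecidablePred (· ∈ H)]

/-- The heavy-exponent weight: `e_y` on a heavy slot `y ∈ H`, `0` on the other slots (values in `σ →₀ ℕ`).
[cite: AbramovichTemkinWlodarczyk2024, §5] -/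
noncomputable def heavyExp : σ → (σ →₀ ℕ) := fun i => if i ∈ H then Finsupp.single i 1 else 0

/-- The `heavyExp`-weight of a monomial is its heavy part `d|_H`. [cite: AbramovichTemkinWlodarczyk2024, §5] -/
theorem weight_heavyExp (d : σ →₀ ℕ) : Finsupp.weight (heavyExp H) d = d.filter (· ∈ H) := by
  rw [Finsupp.weight_apply, Finsupp.sum, Finsupp.filter_eq_sum, Finset.sum_filter]
  refine Finset.sum_congr rfl fun i _ => ?_
  unfold heavyExp
  split_ifs with hi
  · rw [Finsupp.smul_single_one]
  · rw [smul_zero]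

variable {H}

/-- A `heavyExp`-homogeneous `Q ≠ 0` of degree `h` has `h` supported on the heavy slots. [cite: AbramovichTemkinWlodarczyk2024, §5] -/
theorem support_subset_of_isWeightedHomogeneous {Q : MvPolynomial σ R} {h : σ →₀ ℕ}
    (hQ : IsWeightedHomogeneous (heavyExp H) Q h) (hQ0 : Q ≠ 0) : ∀ y ∈ h.support, y ∈ H := by
  obtain ⟨d, hd⟩ := exists_coeff_ne_zero hQ0
  have hhd : h = d.filter (· ∈ H) := by rw [← weight_heavyExp H d]; exact (hQ hd).symm
  intro y hy
  rw [hhd, Finsupp.support_filter, Finset.mem_filter] at hy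
  exact hy.2

/-- In the support of a `heavyExp`-homogeneous `Q` of degree `h`, every monomial `d` has heavy part `h`: `d|_H = h`, so `h ≤ d`.
[cite: AbramovichTemkinWlodarczyk2024, §5] -/
theorem le_of_coeff_ne_zero {Q : MvPolynomial σ R} {h : σ →₀ ℕ} (hQ : IsWeightedHomogeneous (heavyExp H) Q h)
    {d : σ →₀ ℕ} (hd : coeff d Q ≠ 0) : h ≤ d := by
  have hhd : d.filter (· ∈ H) = h := by rw [← weight_heavyExp H d]; exact hQ hd
  rw [← hhd]
  intro y
  rw [Finsupp.filter_apply]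
  split_ifs
  · exact le_rfl
  · exact Nat.zero_le _

/-- … and `d − h` is heavy-free. [cite: AbramovichTemkinWlodarczyk2024, §5] -/
theorem filter_tsub_eq_zero {Q : MvPolynomial σ R} {h : σ →₀ ℕ} (hQ : IsWeightedHomogeneous (heavyExp H) Q h)
    {d : σ →₀ ℕ} (hd : coeff d Q ≠ 0) : (d - h).filter (· ∈ H) = 0 := by
  have hhd : d.filter (· ∈ H) = h := by rw [← weight_heavyExp H d]; exact hQ hd
  ext y
  rw [Finsupp.filter_apply, Finsupp.coe_zero, Pi.zero_apply]
  split_ifs with hy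
  · have := DFunLike.congr_fun hhd y
    rw [Finsupp.filter_apply, if_pos hy] at this
    rw [Finsupp.tsub_apply, this, tsub_self]
  · rfl

/-- The heavy cofactor `G_h := Σ_d coeff_d Q · X^{d − h}` of `Q` (for `Q = comp_h g`: the engine's `G_h`).
[cite: AbramovichTemkinWlodarczyk2024, §5] -/
noncomputable def heavyQuot (h : σ →₀ ℕ) (Q : MvPolynomial σ R) : MvPolynomial σ R :=
  ∑ d ∈ Q.support, monomial (d - h) (coeff d Q)

/-- **The heavy factorisation**: a `heavyExp`-homogeneous `Q` of degree `h` is `X^h · G_h` with `G_h = heavyQuot h Q`.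
[cite: AbramovichTemkinWlodarczyk2024, §5] -/
theorem eq_monomial_mul_heavyQuot {Q : MvPolynomial σ R} {h : σ →₀ ℕ} (hQ : IsWeightedHomogeneous (heavyExp H) Q h) :
    Q = monomial h 1 * heavyQuot h Q := by
  rw [heavyQuot, Finset.mul_sum]
  conv_lhs => rw [Q.as_sum]
  refine Finset.sum_congr rfl fun d hd => ?_
  rw [monomial_mul, one_mul, add_tsub_cancel_of_le (le_of_coeff_ne_zero hQ (mem_support_iff.mp hd))]

/-- The heavy cofactor is heavy-free: `heavyExp`-homogeneous of degree `0`. [cite: AbramovichTemkinWlodarczyk2024, §5] -/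
theorem isWeightedHomogeneous_heavyQuot {Q : MvPolynomial σ R} {h : σ →₀ ℕ} (hQ : IsWeightedHomogeneous (heavyExp H) Q h) :
    IsWeightedHomogeneous (heavyExp H) (heavyQuot h Q) 0 := by
  refine IsWeightedHomogeneous.sum Q.support _ 0 fun d hd => isWeightedHomogeneous_monomial _ _ _ ?_
  rw [weight_heavyExp, filter_tsub_eq_zero hQ (mem_support_iff.mp hd)]

/-- No heavy variable occurs in the heavy cofactor. [cite: AbramovichTemkinWlodarczyk2024, §5] -/
theorem notMem_vars_heavyQuot {Q : MvPolynomial σ R} {h : σ →₀ ℕ} (hQ : IsWeightedHomogeneous (heavyExp H) Q h) {y : σ}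
    (hy : y ∈ H) : y ∉ (heavyQuot h Q).vars := by
  intro hyv
  obtain ⟨d, hd, hyd⟩ := (mem_vars_iff_mem_support y).mp hyv
  have h0 : Finsupp.weight (heavyExp H) d = 0 := isWeightedHomogeneous_heavyQuot hQ (mem_support_iff.mp hd)
  rw [weight_heavyExp] at h0
  have := DFunLike.congr_fun h0 y
  rw [Finsupp.filter_apply, if_pos hy, Finsupp.coe_zero, Pi.zero_apply] at this
  exact (Finsupp.mem_support_iff.mp hyd) this

/-- The components of any polynomial factor this way: `comp_h g = X^h · G_h` for the `heavyExp`-grading.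
[cite: AbramovichTemkinWlodarczyk2024, §5] -/
theorem weightedHomogeneousComponent_eq_monomial_mul (g : MvPolynomial σ R) (h : σ →₀ ℕ) :
    weightedHomogeneousComponent (heavyExp H) h g =
      monomial h 1 * heavyQuot h (weightedHomogeneousComponent (heavyExp H) h g) :=
  eq_monomial_mul_heavyQuot (weightedHomogeneousComponent_isWeightedHomogeneous h g)

/-- Uniqueness of the heavy cofactor over a domain ("the decomposition by heavy part being unique").
[cite: AbramovichTemkinWlodarczyk2024, §5] -/
theorem heavyQuot_unique [IsDomain R] {Q G : MvPolynomial σ R} {h : σ →₀ ℕ} (hQ : IsWeightedHomogeneous (heavyExp H) Q h)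
    (hG : Q = monomial h 1 * G) : G = heavyQuot h Q := by
  have h1 : monomial h (1 : R) ≠ 0 := monomial_eq_zero.not.mpr one_ne_zero
  exact mul_left_cancel₀ h1 (hG.symm.trans (eq_monomial_mul_heavyQuot hQ))

end Heavy

end HeavyDecomposition

end Literature.AlgebraicGeometry.Resolution.WeightedBlowup
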